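import Summits.Schanuel.Schanuel.Theorems.ZilberEacBranchOneDirection
import Summits.Schanuel.Schanuel.Theorems.ZilberEacBranchChartHigherCoefficients
import HarnessLib

/-!
# Arbitrary base branches, XXIX: growth from ANY phase coefficient down to the `τ`-carrying one —
# density inside the residue class from a subleading Puiseux coefficient or from `|θ|`

HONEST FRAMING.  Cell `pub-schanuel` (Zilber's Exponential-Algebraic Closedness, case ladder;
host summit Schanuel), seat 2, gen 29.  Files XIX–XXIII decide density from the top phase
coefficient `Π_M = Φ(0)z^M`, file XXVI from `Π_{M−1} = Φ′(0)z^{M−1}`.  With file XXVIII all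
coefficients down to `Π_{M−k}` are known on the chart with tangent `z` (`z^k = 2πi`):
`Π_{M−j} = φ_j z^{M−j}` for `j < k` and `Π_{M−k} = z^{M−k}(φ_k + (M/k)·log θ·φ_0)`, where
`P_Φ = Σ φ_j X^j` is a Taylor polynomial of `Φ` to order `k` and `log θ` is the principal logarithm
of the fibre value (any other logarithm changes `Π_{M−k}` by a multiple of `Π_M`, whose real part
vanishes in the residue class — the condition below is intrinsic there).  THEOREM G needs only
`Re Π` non-constant, so: **`unprojectedDense_of_witness_coeff_re`** (the growth tail, once:
witness data with `Re Π_N ≠ 0` for some `N ≥ 1` ⟹ dense), and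
**`unprojectedDense_branch_growth_of_taylor_coeff`** — a cylinder germ
`(s^{-k}, Φ(s)s^{-M}, ψ(s), e^{x₁})` (`1 ≤ k < M`, `ψ(0) = θ ≠ 0`) in an irreducible closed `S` of
dimension `≤ 2` is Zariski-dense in `S` as soon as, for SOME `k`-th root `z` of `2πi` and SOME
`1 ≤ j ≤ k`, `Re(z^{M−j}(φ_j + [j = k](M/k)·log θ·Φ(0))) ≠ 0`; in particular
(**`unprojectedDense_branch_growth_of_tau_coeff`**) when `Re(z^{M−k}(φ_k + (M/k) log θ Φ(0))) ≠ 0`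
— the first density criterion that depends on the MODULUS of the fibre value (through
`Re log θ = log |θ|`): e.g. constant fibres `y₀ = θ` over `x₁ = x₀³ + …` (`k = 1`, `M = 3`) or over
even-degree hyperelliptic curves (`k = 2`) are dense for `|θ|` off one circle (next file).
Decided instances of an OPEN question (Mantova–Masser, PLMS 2024 §1 p. 5); EC(3,2) OPEN; NOT
Schanuel's conjecture (neither used nor implied); EAC ⇏ SC.
-/

noncomputable section

open Filter Topology Polynomial Bornology Complex
open Literature.NumberTheory.Transcendental Literature.ModelTheory.Zilber
open Literature.ModelTheory.ExponentialFields

set_option linter.dupNamespace false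

namespace Summit.Schanuel.Schanuel.Theorems

/-! ## Part A. The growth tail, once and for all -/

/-- **Growth from a phase coefficient.**  Given the output of the witness construction (file I) —
points `q_j = (σ_j^{-k}, Φ(σ_j)σ_j^{-M}, ψ(σ_j), e^{x₁}) ∈ S` with `e^{x₀} = y₀` and
`x₁(q_j) = Π(m₀ + j) + r(μ_j)`, `μ_j → 0`, `r` analytic at `0` — and `Re Π_N ≠ 0` for some `N ≥ 1`,
the real part of `x₁` grows polynomially in the label while `log ‖x₁‖` grows logarithmically, so
THEOREM G (`unprojectedDense_of_growth`) gives Zariski density.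
[cite: MantovaMasser2023, §1 Further remarks, p. 5 (the question, open in general)] (new) -/
theorem unprojectedDense_of_witness_coeff_re {S : Set (Fin 2 ⊕ Fin 2 → ℂ)}
    (hS : IsIrreducibleClosed ℂ S) (hdim : zariskiDim ℂ S ≤ (2 : ℕ)) {k M : ℕ} {ψ Φ : ℂ → ℂ}
    {r : ℂ → ℂ} (hran : AnalyticAt ℂ r 0) {Pl : ℂ[X]} {m₀ : ℕ} {μ σ : ℕ → ℂ}
    (hμ : Tendsto μ atTop (𝓝 0))
    (hGσ : ∀ j, (Sum.elim ![(σ j ^ k)⁻¹, Φ (σ j) * (σ j ^ M)⁻¹]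
        ![ψ (σ j), Complex.exp (Φ (σ j) * (σ j ^ M)⁻¹)] : Fin 2 ⊕ Fin 2 → ℂ) ∈ S)
    (hexpσ : ∀ j, Complex.exp ((σ j ^ k)⁻¹) = ψ (σ j))
    (hid₁ : ∀ j, Φ (σ j) * (σ j ^ M)⁻¹ = Pl.eval ((m₀ + j : ℕ) : ℂ) + r (μ j))
    {N : ℕ} (hN : 1 ≤ N) (hre : (Pl.coeff N).re ≠ 0) : UnprojectedDense S := by
  classical
  -- the points
  set q : ℕ → Fin 2 ⊕ Fin 2 → ℂ := fun j =>
    Sum.elim ![(σ j ^ k)⁻¹, Φ (σ j) * (σ j ^ M)⁻¹]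
      ![ψ (σ j), Complex.exp (Φ (σ j) * (σ j ^ M)⁻¹)] with hq
  have hqS : ∀ j, q j ∈ S := fun j => hGσ j
  have hqΓ : ∀ j, q j ∈ expGraph ℂ 2 := by
    intro j
    rw [mem_expGraph_iff]
    intro i
    rw [Literature.ModelTheory.ExponentialFields.ExponentialRing.complex_exp_eq]
    fin_cases i
    · simp [hq, hexpσ j]
    · simp [hq]
  have hid : ∀ j, q j (Sum.inl 1) = Pl.eval ((m₀ + j : ℕ) : ℂ) + r (μ j) := fun j => by
    simp only [hq, Sum.elim_inl, Matrix.cons_val_one, Matrix.cons_val_zero]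
    exact hid₁ j
  -- GROWTH (as in files XV, XIX, XXVI, with `Re Π_N ≠ 0`, `N ≥ 1`)
  obtain ⟨gR, gI, hgR, -⟩ := exists_re_im_polynomials Pl
  have hgRdeg : 1 ≤ gR.natDegree := le_trans hN (le_natDegree_rePoly hgR hre)
  have hcast : ∀ j, ((m₀ + j : ℕ) : ℂ) = (((m₀ + j : ℕ) : ℝ) : ℂ) := fun j => by
    rw [Complex.ofReal_natCast]
  have hrlim : Tendsto (fun j => r (μ j)) atTop (𝓝 (r 0)) := hran.continuousAt.tendsto.comp hμ
  have hreq : ∀ j, (q j (Sum.inl 1)).re = gR.eval ((m₀ + j : ℕ) : ℝ) + (r (μ j)).re := by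
    intro j
    rw [hid j, Complex.add_re, hcast, hgR]
  obtain ⟨B, hB⟩ : ∃ B : ℝ, ∀ j, ‖r (μ j)‖ ≤ B := by
    obtain ⟨C, hC⟩ := isBounded_iff_forall_norm_le.1 (Metric.isBounded_range_of_tendsto _ hrlim)
    exact ⟨C, fun j => hC _ ⟨j, rfl⟩⟩
  have hB0 : 0 ≤ B := (norm_nonneg _).trans (hB 0)
  have ha : ∀ j, |(q j (Sum.inl 1)).re - gR.eval ((m₀ + j : ℕ) : ℝ)| ≤ B := by
    intro j
    rw [hreq j, add_sub_cancel_left]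
    exact (Complex.abs_re_le_norm _).trans (hB j)
  obtain ⟨D, hD, hLD⟩ := log_two_add_norm_eval_le_log_label Pl (le_refl (0 : ℝ))
  have hLD' : ∀ j, Real.log (2 + ‖q j (Sum.inl 1)‖) ≤
      (D + Real.log (1 + B)) * Real.log (3 + 3 * ((m₀ + j : ℕ) : ℝ)) := by
    intro j
    have hlab0 : (0 : ℝ) ≤ ((m₀ + j : ℕ) : ℝ) := Nat.cast_nonneg _
    have h1 : Real.log (2 + ‖Pl.eval ((m₀ + j : ℕ) : ℂ)‖) ≤
        D * Real.log (3 + 3 * ((m₀ + j : ℕ) : ℝ)) := by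
      refine hLD _ _ hlab0 ?_
      rw [Complex.norm_natCast, zero_add]
      linarith
    have h2 : ‖q j (Sum.inl 1)‖ ≤ ‖Pl.eval ((m₀ + j : ℕ) : ℂ)‖ + B := by
      rw [hid j]
      exact (norm_add_le _ _).trans (by linarith [hB j])
    calc Real.log (2 + ‖q j (Sum.inl 1)‖)
        ≤ Real.log (2 + ‖Pl.eval ((m₀ + j : ℕ) : ℂ)‖ + B) :=
          Real.log_le_log (by positivity) (by linarith)
      _ ≤ (D + Real.log (1 + B)) * Real.log (3 + 3 * ((m₀ + j : ℕ) : ℝ)) :=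
          log_two_add_add_le (norm_nonneg _) hB0 (one_le_log_three_add _ hlab0) h1
  have hD' : 0 < D + Real.log (1 + B) := by
    have := Real.log_nonneg (by linarith : (1 : ℝ) ≤ 1 + B)
    linarith
  have hgr : Tendsto (fun j => |(q j (Sum.inl 1)).re| / Real.log (2 + ‖q j (Sum.inl 1)‖))
      atTop atTop :=
    tendsto_abs_div_log_of_linear_growth hgRdeg m₀ hD' ha
      (fun j => Real.log_le_log two_pos (by linarith [norm_nonneg (q j (Sum.inl 1))])) hLD'
  exact unprojectedDense_of_growth hS hdim 1 hqS hqΓ hgr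

/-! ## Part B. Growth from any phase coefficient `Π_{M−j}`, `1 ≤ j ≤ k` -/

/-- The constant term of a Taylor polynomial to order `k ≥ 1` of a function continuous at `0` is
its value at `0`. [folklore] -/
theorem taylorPoly_coeff_zero_eq {Φ : ℂ → ℂ} (hΦ : ContinuousAt Φ 0) {PΦ : ℂ[X]} {k : ℕ}
    (hk : 1 ≤ k) (hΦT : Tendsto (fun s => (Φ s - PΦ.eval s) / s ^ k) (𝓝[≠] (0 : ℂ)) (𝓝 0)) :
    PΦ.coeff 0 = Φ 0 := by
  have h1 : Tendsto (fun s => (Φ s - PΦ.eval s) / s ^ k * s ^ k) (𝓝[≠] (0 : ℂ)) (𝓝 0) := by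
    have h := hΦT.mul (tendsto_pow_punctured hk)
    rwa [zero_mul] at h
  have h2 : Tendsto (fun s => Φ s - PΦ.eval s) (𝓝[≠] (0 : ℂ)) (𝓝 (Φ 0 - PΦ.coeff 0)) := by
    have hP : Tendsto (fun s : ℂ => PΦ.eval s) (𝓝 (0 : ℂ)) (𝓝 (PΦ.eval 0)) :=
      PΦ.continuousAt.tendsto
    rw [← Polynomial.coeff_zero_eq_eval_zero] at hP
    exact (hΦ.tendsto.sub hP).mono_left nhdsWithin_le_nhds
  have h3 : Φ 0 - PΦ.coeff 0 = 0 := by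
    refine tendsto_nhds_unique h2 (h1.congr' ?_)
    filter_upwards [self_mem_nhdsWithin] with s (hs : s ≠ 0)
    rw [div_mul_cancel₀ _ (pow_ne_zero _ hs)]
  exact (sub_eq_zero.1 h3).symm

/-- **Growth from any phase coefficient down to the `τ`-carrying one.**  A cylinder germ
`(s^{-k}, Φ(s)s^{-M}, ψ(s), e^{x₁})` (`1 ≤ k < M`, `ψ(0) = θ ≠ 0`) in an irreducible closed `S` of
dimension `≤ 2`, with a Taylor polynomial `P_Φ = Σ φ_j X^j` of `Φ` to order `k`, and with
`Re(z^{M−j}(φ_j + [j = k]·(M/k)·log θ·Φ(0))) ≠ 0` for SOME `k`-th root `z` of `2πi` and SOME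
`1 ≤ j ≤ k`, gives Zariski-dense exponential points: on the chart with tangent `z` the phase
polynomial has exactly this number as `Π_{M−j}` (file XXVIII), so `Re Π` is non-constant and
THEOREM G applies. [cite: MantovaMasser2023, §1 Further remarks, p. 5 (the question, open in
general)] (new) -/
theorem unprojectedDense_branch_growth_of_taylor_coeff {S : Set (Fin 2 ⊕ Fin 2 → ℂ)}
    (hS : IsIrreducibleClosed ℂ S) (hdim : zariskiDim ℂ S ≤ (2 : ℕ))
    {k M : ℕ} (hk : 1 ≤ k) (hkM : k < M) {ψ : ℂ → ℂ} (hψ : AnalyticAt ℂ ψ 0) {θ : ℂ}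
    (hθ0 : θ ≠ 0) (hψ0 : ψ 0 = θ) {Φ : ℂ → ℂ} (hΦ : AnalyticAt ℂ Φ 0) {PΦ : ℂ[X]}
    (hPΦ : PΦ.natDegree ≤ k)
    (hΦT : Tendsto (fun s => (Φ s - PΦ.eval s) / s ^ k) (𝓝[≠] (0 : ℂ)) (𝓝 0))
    (hdir : ∃ z : ℂ, z ^ k = 2 * Real.pi * I ∧ ∃ j : ℕ, 1 ≤ j ∧ j ≤ k ∧
      (z ^ (M - j) * (PΦ.coeff j +
        if j = k then (M : ℂ) / k * Complex.log θ * Φ 0 else 0)).re ≠ 0)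
    (hgerm : ∀ᶠ s in 𝓝[≠] (0 : ℂ),
      (Sum.elim ![(s ^ k)⁻¹, Φ s * (s ^ M)⁻¹] ![ψ s, Complex.exp (Φ s * (s ^ M)⁻¹)] :
        Fin 2 ⊕ Fin 2 → ℂ) ∈ S) :
    UnprojectedDense S := by
  classical
  obtain ⟨z, hz, j, hj1, hjk, hzre⟩ := hdir
  -- `θ = e^τ`; chart WITH TANGENT `z`; witness
  set τ : ℂ := Complex.log θ with hτdef
  have hτ : Complex.exp τ = θ := Complex.exp_log hθ0
  obtain ⟨m, hman, hm0, hmz, hchart⟩ := exists_ramifiedChart_root hψ hθ0 hψ0 τ hk hz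
  have h2πI : (2 * Real.pi * I : ℂ) ≠ 0 := by simp [Real.pi_ne_zero, Complex.I_ne_zero]
  have hz0 : z ≠ 0 := by
    rintro rfl
    rw [zero_pow (by omega)] at hz
    exact h2πI hz.symm
  have hm' : deriv m 0 ≠ 0 := by rw [hmz]; exact hz0
  obtain ⟨U, r, Pl, m₀, μ, σ, -, -, hran, hPldeg, -, hside, -, hμ, -, hGσ, -, hexpσ, -,
      -, hid₁⟩ :=
    exists_ramified_witness_branch hθ0 hτ hk hgerm hman hm0 hm' hchart hΦ M
  -- the coefficient `Π_{M−j}`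
  have hΦ0 : PΦ.coeff 0 = Φ 0 := taylorPoly_coeff_zero_eq hΦ.continuousAt hk hΦT
  have hcoeff : Pl.coeff (M - j) = z ^ (M - j) * (PΦ.coeff j +
      if j = k then (M : ℂ) / k * Complex.log θ * Φ 0 else 0) := by
    rcases hjk.lt_or_eq with hlt | rfl
    · rw [if_neg hlt.ne, add_zero, ← hmz, mul_comm]
      exact laurentPart_coeff_eq_of_lt hψ hθ0 hψ0 hk hman hm0 hchart hPΦ hΦT hkM hPldeg hran
        (hside.mono fun s h => h.2) hlt
    · rw [if_pos rfl, ← hmz, ← hΦ0]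
      exact laurentPart_coeff_tau_eq hψ hθ0 hψ0 hk hman hm0 hchart hPΦ hΦT hkM hPldeg hran
        (hside.mono fun s h => h.2)
  have hre : (Pl.coeff (M - j)).re ≠ 0 := by rw [hcoeff]; exact hzre
  exact unprojectedDense_of_witness_coeff_re hS hdim hran hμ hGσ hexpσ hid₁ (by omega) hre

/-- **Growth from the `τ`-carrying coefficient.**  As above with `j = k`: density as soon as
`Re(z^{M−k}(φ_k + (M/k)·log θ·Φ(0))) ≠ 0` for SOME `k`-th root `z` of `2πi` — a criterion that
involves the MODULUS of the fibre value `θ` (`Re log θ = log |θ|`). [cite: MantovaMasser2023, §1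
Further remarks, p. 5 (the question, open in general)] (new) -/
theorem unprojectedDense_branch_growth_of_tau_coeff {S : Set (Fin 2 ⊕ Fin 2 → ℂ)}
    (hS : IsIrreducibleClosed ℂ S) (hdim : zariskiDim ℂ S ≤ (2 : ℕ))
    {k M : ℕ} (hk : 1 ≤ k) (hkM : k < M) {ψ : ℂ → ℂ} (hψ : AnalyticAt ℂ ψ 0) {θ : ℂ}
    (hθ0 : θ ≠ 0) (hψ0 : ψ 0 = θ) {Φ : ℂ → ℂ} (hΦ : AnalyticAt ℂ Φ 0) {PΦ : ℂ[X]}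
    (hPΦ : PΦ.natDegree ≤ k)
    (hΦT : Tendsto (fun s => (Φ s - PΦ.eval s) / s ^ k) (𝓝[≠] (0 : ℂ)) (𝓝 0))
    (hdir : ∃ z : ℂ, z ^ k = 2 * Real.pi * I ∧
      (z ^ (M - k) * (PΦ.coeff k + (M : ℂ) / k * Complex.log θ * Φ 0)).re ≠ 0)
    (hgerm : ∀ᶠ s in 𝓝[≠] (0 : ℂ),
      (Sum.elim ![(s ^ k)⁻¹, Φ s * (s ^ M)⁻¹] ![ψ s, Complex.exp (Φ s * (s ^ M)⁻¹)] :
        Fin 2 ⊕ Fin 2 → ℂ) ∈ S) :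
    UnprojectedDense S := by
  obtain ⟨z, hz, hzre⟩ := hdir
  refine unprojectedDense_branch_growth_of_taylor_coeff hS hdim hk hkM hψ hθ0 hψ0 hΦ hPΦ hΦT
    ⟨z, hz, k, hk, le_rfl, ?_⟩ hgerm
  rw [if_pos rfl]
  exact hzre

/-- **Growth from an intermediate Puiseux coefficient.**  As above with `1 ≤ j < k`: density as
soon as `Re(φ_j z^{M−j}) ≠ 0` for SOME `k`-th root `z` of `2πi` (file XXVI is `j = 1`).
[cite: MantovaMasser2023, §1 Further remarks, p. 5 (the question, open in general)] (new) -/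
theorem unprojectedDense_branch_growth_of_mid_coeff {S : Set (Fin 2 ⊕ Fin 2 → ℂ)}
    (hS : IsIrreducibleClosed ℂ S) (hdim : zariskiDim ℂ S ≤ (2 : ℕ))
    {k M : ℕ} (hk : 1 ≤ k) (hkM : k < M) {ψ : ℂ → ℂ} (hψ : AnalyticAt ℂ ψ 0) {θ : ℂ}
    (hθ0 : θ ≠ 0) (hψ0 : ψ 0 = θ) {Φ : ℂ → ℂ} (hΦ : AnalyticAt ℂ Φ 0) {PΦ : ℂ[X]}
    (hPΦ : PΦ.natDegree ≤ k)
    (hΦT : Tendsto (fun s => (Φ s - PΦ.eval s) / s ^ k) (𝓝[≠] (0 : ℂ)) (𝓝 0))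
    (hdir : ∃ z : ℂ, z ^ k = 2 * Real.pi * I ∧ ∃ j : ℕ, 1 ≤ j ∧ j < k ∧
      (PΦ.coeff j * z ^ (M - j)).re ≠ 0)
    (hgerm : ∀ᶠ s in 𝓝[≠] (0 : ℂ),
      (Sum.elim ![(s ^ k)⁻¹, Φ s * (s ^ M)⁻¹] ![ψ s, Complex.exp (Φ s * (s ^ M)⁻¹)] :
        Fin 2 ⊕ Fin 2 → ℂ) ∈ S) :
    UnprojectedDense S := by
  obtain ⟨z, hz, j, hj1, hjk, hzre⟩ := hdir
  refine unprojectedDense_branch_growth_of_taylor_coeff hS hdim hk hkM hψ hθ0 hψ0 hΦ hPΦ hΦT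
    ⟨z, hz, j, hj1, hjk.le, ?_⟩ hgerm
  rw [if_neg hjk.ne, add_zero, mul_comm]
  exact hzre

end Summit.Schanuel.Schanuel.Theorems

end
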